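import Summits.PneNP.PneNP.Theorems.ExpanderLinearGeneratorsLinearGeneratorModPFregeHardPolyCalc
import Literature.Computability.MetaComplexity.GaussianWidth
import Mathlib.Algebra.CharP.Two
import Mathlib.Data.List.Sublists
import HarnessLib

/-!
# Characteristic `2` is easy for the polynomial calculus on XOR-CNFs (calibration of the
polynomial calculus rung, item stmt-PneNP-11444)

Route `PneNP/ExpanderLinearGenerators`, crux `LinearGeneratorModPFregeHard`.  The PC rung
(`…PolyCalcDegree.lean`, `…LinearGeneratorModPFregeHardPolyCalc.lean`) bounds the degree of
PC/`K`-refutations of the XOR-CNF `sumEncoding 1 E` of an expander from below by `c r / 4` for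
every field `K` with `2 ≠ 0`.  This file shows that the hypothesis `2 ≠ 0` is necessary, exactly
as `p ≠ 2` is in the crux (`…Mod2Easy.lean`, `…ModPFregeHardWitnesses.lean`): over `𝔽₂` the
clause polynomials of ANY unsolvable `ℓ`-sparse system have a PC refutation of degree `ℓ` —
indeed a Nullstellensatz refutation with CONSTANT multipliers —, expansion or not.

* `rowPolySum_eq` — over `𝔽₂` the clause polynomials of the canonical CNF of a row `e` add up,
  as polynomials, to the affine form `Σ_{j ∈ supp e} x_j + b_e` (the violation indicator is
  multilinear of degree one in characteristic `2`);
* `refutableInDegree_sumEncoding_zmod_two` — for every unsolvable `ℓ`-sparse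
  `E : Fin m → LinEqMod 2 n`, `PC.RefutableInDegree (cnfPolys (ZMod 2) (sumEncoding 1 E)) ℓ`:
  multiply the clause polynomials of row `i` by the coefficient `vᵢ` of a dual certificate
  `Σ vᵢ Eᵢ = (0 = 1)` (`exists_lincomb_eq_zero_one`) and add;
* `polyCalc_rung_modulus_dichotomy` — the two facts side by side on the item's instances.

References: S. Buss, D. Grigoriev, R. Impagliazzo, T. Pitassi, JCSS 62 (2001) §1 (PC refutes
linear systems over its own characteristic in low degree); E. Ben-Sasson, R. Impagliazzo,
Comput. Complexity 19 (2010) §4; J. Krajíček, *Proof Complexity* (2019) §6.2, §15.6.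
-/

noncomputable section

set_option linter.dupNamespace false -- `Summit.PneNP.PneNP.…`: summit = sub-problem (D-0017)

namespace Summit.PneNP.PneNP.Theorems.PolyCalc

open Finset MvPolynomial Literature.Computability.Complexity Literature.Computability.MetaComplexity
open Summit.PneNP.PneNP.Theorems.ModTwo

/-! ### The clause polynomials of one row add up to an affine form over `𝔽₂` -/

section RowSum

/-- The literal factor of variable `v` against the true-set `S`: `x_v` if `v ∈ S`, else
`1 - x_v` (the factor of `unsatPolyK` of the canonical clause excluding `S`). [folklore] -/
def litFactor (S : List ℕ) (v : ℕ) : MvPolynomial ℕ (ZMod 2) :=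
  if v ∈ S then X v else 1 - X v

/-- The parity-filtered sum over the sub-lists of `V` of the products of literal factors:
`Σ_{S ⊆ V, |S| ≡ t} ∏_{v ∈ V} litFactor S v` (with `sublists'`, convenient for induction).
[folklore] -/
def paritySum (V : List ℕ) (t : ZMod 2) : MvPolynomial ℕ (ZMod 2) :=
  ((V.sublists'.filter fun S => ((S.length : ℕ) : ZMod 2) = t).map
    fun S => (V.map (litFactor S)).prod).sum

/-- **The parity sum is affine**: for a duplicate-free `V`,
`Σ_{S ⊆ V, |S| ≡ t} ∏_{v ∈ V} litFactor S v = Σ_{v ∈ V} x_v + (t + 1)` over `𝔽₂`.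
(Induction on `V`: splitting off `a`, the sub-lists not containing `a` carry the factor `1 - x_a`,
those containing it the factor `x_a` with flipped parity; `-x_a = x_a`.) [folklore] -/
theorem paritySum_eq : ∀ (V : List ℕ), V.Nodup → ∀ t : ZMod 2,
    paritySum V t = (V.map X).sum + C (t + 1)
  | [], _, t => by
    unfold paritySum
    by_cases ht : t = 0
    · subst ht; simp
    · have ht1 : t = 1 := by revert ht; revert t; decide
      subst ht1
      have h2 : (1 : ZMod 2) + 1 = 0 := by decide
      simp [h2, (show (0 : ZMod 2) ≠ 1 by decide)]
  | a :: V, hnd, t => by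
    have haV : a ∉ V := (List.nodup_cons.1 hnd).1
    have hV : V.Nodup := (List.nodup_cons.1 hnd).2
    -- products over `a :: V` for sub-lists of `V` and for `a :: S`
    have hprodS : ∀ S ∈ V.sublists', ((a :: V).map (litFactor S)).prod =
        (1 - X a) * (V.map (litFactor S)).prod := by
      intro S hS
      have haS : a ∉ S := fun h => haV ((List.mem_sublists'.1 hS).subset h)
      rw [List.map_cons, List.prod_cons, litFactor, if_neg haS]
    have hprodaS : ∀ S ∈ V.sublists', ((a :: V).map (litFactor (a :: S))).prod =
        X a * (V.map (litFactor S)).prod := by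
      intro S hS
      rw [List.map_cons, List.prod_cons, litFactor, if_pos List.mem_cons_self]
      congr 1
      refine congrArg List.prod (List.map_congr_left fun v hv => ?_)
      have hva : v ≠ a := fun h => haV (h ▸ hv)
      simp [litFactor, List.mem_cons, hva]
    -- split the sum
    have hsplit : paritySum (a :: V) t =
        (1 - X a) * paritySum V t + X a * paritySum V (t + 1) := by
      unfold paritySum
      rw [List.sublists'_cons, List.filter_append, List.map_append, List.sum_append,
        List.filter_map, List.map_map]
      congr 1
      · rw [← List.sum_map_mul_left]
        refine congrArg List.sum (List.map_congr_left fun S hS => ?_)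
        exact hprodS S (List.mem_filter.1 hS).1
      · rw [← List.sum_map_mul_left]
        have hfilt : V.sublists'.filter ((fun S => decide (((S.length : ℕ) : ZMod 2) = t)) ∘
            List.cons a) = V.sublists'.filter fun S => decide (((S.length : ℕ) : ZMod 2) = t + 1) := by
          refine List.filter_congr fun S _ => ?_
          simp only [Function.comp_apply, List.length_cons, Nat.cast_succ]
          generalize ((S.length : ℕ) : ZMod 2) = x
          revert x; revert t
          decide
        rw [hfilt]
        refine congrArg List.sum (List.map_congr_left fun S hS => ?_)
        exact hprodaS S (List.mem_filter.1 hS).1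
    rw [hsplit, paritySum_eq V hV t, paritySum_eq V hV (t + 1), List.map_cons, List.sum_cons]
    simp only [map_add, map_one]
    ring

end RowSum

/-! ### The canonical CNF of a row over `𝔽₂` -/

section Row

variable {n : ℕ}

/-- The clause polynomial of the canonical clause excluding `S` is the product of the literal
factors. [Krajíček 2019, (6.0.1)] [folklore] -/
theorem unsatPolyK_canonClause (V S : List ℕ) :
    unsatPolyK (ZMod 2) (V.map fun v => (v, decide (v ∉ S))) = (V.map (litFactor S)).prod := by
  rw [unsatPolyK, List.map_map]
  congr 1
  refine List.map_congr_left fun v _ => ?_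
  by_cases h : v ∈ S <;> simp [litFalsePolyK, litFactor, h]

/-- The sum of the clause polynomials of one row. [folklore] -/
def rowPolySum (e : LinEqMod 2 n) : MvPolynomial ℕ (ZMod 2) :=
  ((equationCNF 1 e).map (unsatPolyK (ZMod 2))).sum

/-- **Over `𝔽₂` the clause polynomials of a row add up to its affine form**:
`Σ_{C ∈ equationCNF 1 e} unsatPolyK C = Σ_{j ∈ supp e} x_j + b_e`. [Buss–Grigoriev–Impagliazzo–
Pitassi 2001, §1; Krajíček 2019, §6.2] [folklore] -/
theorem rowPolySum_eq (e : LinEqMod 2 n) :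
    rowPolySum e = (∑ j ∈ e.supp, X (j : ℕ)) + C e.2 := by
  set V := (e.supp.map Fin.valEmbedding).sort (· ≤ ·) with hV
  have hVnd : V.Nodup := Finset.sort_nodup _ _
  -- rewrite the row sum as a parity sum over `sublists V`
  have h1 : rowPolySum e = ((V.sublists.filter fun S => ((S.length : ℕ) : ZMod 2) = e.2 + 1).map
      fun S => (V.map (litFactor S)).prod).sum := by
    rw [rowPolySum, equationCNF, canonicalCNF, eqVars_one, ← hV, List.map_map]
    have key : ∀ a b : ZMod 2, (a = b + 1 ↔ ¬ a = b) := by decide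
    have hfilt : V.sublists.filter (fun S => !eqPred 1 e S) =
        V.sublists.filter fun S => decide (((S.length : ℕ) : ZMod 2) = e.2 + 1) := by
      refine List.filter_congr fun S hS => ?_
      have hsub : S.Sublist V := List.mem_sublists.1 hS
      have hlen : ((S.length : ℕ) : ZMod 2) = ∑ j ∈ e.supp, if (j : ℕ) ∈ S then 1 else 0 := by
        rw [← filter_mem_eq_of_sublist hsub hVnd, length_filter_cast_eq_sum (fun v => decide (v ∈ S)) V,
          hV, sum_sort_map, Finset.sum_map]
        refine Finset.sum_congr rfl fun j hj => ?_
        have hjV : (j : ℕ) ∈ (e.supp.map Fin.valEmbedding).sort (· ≤ ·) :=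
          (mem_sort_supp_iff e).2 ⟨j, hj, rfl⟩
        by_cases h : (j : ℕ) ∈ S <;> simp [h, hjV]
      have hpar : eqPred 1 e S = true ↔ ((S.length : ℕ) : ZMod 2) = e.2 := by
        rw [eqPred_one_iff, hlen]
      cases hP : eqPred 1 e S with
      | false =>
        have hne : ¬ ((S.length : ℕ) : ZMod 2) = e.2 := fun h => by
          have := hpar.2 h
          rw [hP] at this
          exact Bool.false_ne_true this
        rw [Bool.not_false]
        exact (decide_eq_true ((key _ _).2 hne)).symm
      | true =>
        have heq := hpar.1 hP
        rw [Bool.not_true]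
        exact (decide_eq_false fun h => (key _ _).1 h heq).symm
    rw [hfilt]
    congr 1
    refine List.map_congr_left fun S _ => ?_
    exact unsatPolyK_canonClause V S
  -- pass to `sublists'` (a permutation) and apply the parity-sum identity
  have h2 : ((V.sublists.filter fun S => ((S.length : ℕ) : ZMod 2) = e.2 + 1).map
      fun S => (V.map (litFactor S)).prod).sum = paritySum V (e.2 + 1) :=
    List.Perm.sum_eq (((List.sublists_perm_sublists' V).filter _).map _)
  rw [h1, h2, paritySum_eq V hVnd, add_assoc, CharTwo.add_self_eq_zero, add_zero]
  congr 1
  rw [hV, ← List.sum_toFinset _ (Finset.sort_nodup _ _), Finset.sort_toFinset, Finset.sum_map]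
  rfl

/-- The affine form of a row as a coefficient sum: `Σ_{j ∈ supp e} x_j = Σ_j a_j • x_j`
(coefficients in `𝔽₂` are `0` or `1`). [folklore] -/
theorem sum_supp_X_eq (e : LinEqMod 2 n) :
    (∑ j ∈ e.supp, X (j : ℕ) : MvPolynomial ℕ (ZMod 2)) = ∑ j, e.1 j • X (j : ℕ) := by
  rw [LinEqMod.supp, Finset.sum_filter]
  refine Finset.sum_congr rfl fun j _ => ?_
  by_cases h : e.1 j = 0
  · simp [h]
  · have h1 : e.1 j = 1 := by revert h; generalize e.1 j = a; revert a; decide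
    simp [h1]

end Row

/-! ### The refutation over `𝔽₂` -/

section Refutation

variable {n m : ℕ}

/-- A nonempty list of degree-`≤ d` derivable polynomials has a derivable sum. [folklore] -/
theorem derivable_listSum {K : Type*} [Field K] {𝓕 : Set (MvPolynomial ℕ K)} {d : ℕ} :
    ∀ (L : List (MvPolynomial ℕ K)), L ≠ [] → (∀ f ∈ L, PC.DerivableInDegree 𝓕 d f) →
      PC.DerivableInDegree 𝓕 d L.sum
  | [], h, _ => absurd rfl h
  | [f], _, h => by simpa using h f (by simp)
  | f :: g :: L, _, h => by
    rw [List.sum_cons]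
    exact .add (h f (by simp)) (derivable_listSum (g :: L) (by simp) fun f' hf' => h f' (by simp [hf']))

/-- One row of the certificate: `Σ_{C ∈ row i} unsatPolyK C · vᵢ = vᵢ • (Σ_j aᵢⱼ x_j + bᵢ)`.
[folklore] -/
theorem sum_rowList_eq (E : Fin m → LinEqMod 2 n) (v : Fin m → ZMod 2) (i : Fin m) :
    ((equationCNF 1 (E i)).map fun Cl => unsatPolyK (ZMod 2) Cl * C (v i)).sum =
      v i • ((∑ j, (E i).1 j • X (j : ℕ)) + C (E i).2) := by
  rw [List.sum_map_mul_right, ← sum_supp_X_eq, ← rowPolySum_eq, rowPolySum,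
    MvPolynomial.smul_eq_C_mul, mul_comm]

/-- **The certificate polynomial**: for coefficients `v`, all the `unsatPolyK C · vᵢ`, `C` a
clause of row `i`, add up to `Σ_j (Σᵢ vᵢ aᵢⱼ) x_j + Σᵢ vᵢ bᵢ = Σ_j (lincomb v E)ⱼ x_j +
(lincomb v E).2`. [folklore] -/
theorem sum_certList_eq (E : Fin m → LinEqMod 2 n) (v : Fin m → ZMod 2) :
    (((List.finRange m).map fun i =>
        (equationCNF 1 (E i)).map fun Cl => unsatPolyK (ZMod 2) Cl * C (v i)).flatten).sum =
      (∑ j, (lincomb v E).1 j • X (j : ℕ)) + C ((lincomb v E).2) := by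
  set g : Fin m → List (MvPolynomial ℕ (ZMod 2)) := fun i =>
    (equationCNF 1 (E i)).map fun Cl => unsatPolyK (ZMod 2) Cl * C (v i) with hg
  rw [List.sum_flatten, List.map_map]
  have hfun : (List.sum ∘ g) = fun i => v i • ((∑ j, (E i).1 j • X (j : ℕ)) + C (E i).2) := by
    funext i
    exact sum_rowList_eq E v i
  rw [hfun, ← Fin.sum_univ_def]
  simp only [smul_add, Finset.sum_add_distrib, Finset.smul_sum, smul_smul]
  congr 1
  · rw [Finset.sum_comm]
    refine Finset.sum_congr rfl fun j _ => ?_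
    rw [← Finset.sum_smul]
    rfl
  · simp only [MvPolynomial.smul_eq_C_mul, ← map_mul, ← map_sum]
    rfl

/-- **Over `𝔽₂`, PC refutes the XOR-CNF of every unsolvable `ℓ`-sparse system in degree `ℓ`**
(in fact by a Nullstellensatz certificate with constant multipliers: `Σᵢ vᵢ Σ_{C ∈ row i}
unsatPolyK C = 1` for a dual certificate `v`).  So the hypothesis `2 ≠ 0` of the PC rung is
necessary — the algebraic rung has the same modulus dichotomy as the crux (`p ≠ 2`).
[Buss–Grigoriev–Impagliazzo–Pitassi 2001, §1; Krajíček 2019, §6.2] [folklore] -/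
theorem refutableInDegree_sumEncoding_zmod_two (E : Fin m → LinEqMod 2 n) {ℓ : ℕ}
    (hsparse : ∀ i, (E i).supp.card ≤ ℓ) (hE : ¬ SystemSat E Finset.univ) :
    PC.RefutableInDegree (cnfPolys (ZMod 2) (sumEncoding 1 E)) ℓ := by
  haveI : Fact (Nat.Prime 2) := ⟨Nat.prime_two⟩
  obtain ⟨v, hv⟩ := exists_lincomb_eq_zero_one E hE
  set L := ((List.finRange m).map fun i =>
    (equationCNF 1 (E i)).map fun Cl => unsatPolyK (ZMod 2) Cl * C (v i)).flatten with hL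
  have hsum : L.sum = 1 := by
    rw [hL, sum_certList_eq, hv]
    simp
  have hne : L ≠ [] := by
    intro h
    rw [h, List.sum_nil] at hsum
    exact zero_ne_one hsum
  unfold PC.RefutableInDegree
  rw [← hsum]
  refine derivable_listSum L hne fun f hf => ?_
  rw [hL, List.mem_flatten] at hf
  obtain ⟨l, hl, hf⟩ := hf
  obtain ⟨i, -, rfl⟩ := List.mem_map.1 hl
  obtain ⟨Cl, hCl, rfl⟩ := List.mem_map.1 hf
  have hmem : Cl ∈ sumEncoding 1 E := by
    rw [sumEncoding, List.mem_flatMap]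
    exact ⟨i, List.mem_finRange i, hCl⟩
  have hdeg : (unsatPolyK (ZMod 2) Cl).totalDegree ≤ ℓ := by
    obtain ⟨S, -, -, rfl⟩ := exists_of_mem_equationCNF_one hCl
    rw [totalDegree_unsatPolyK, length_canonClause]
    exact hsparse i
  refine .mul (C (v i)) (.hyp ⟨Cl, hmem, rfl⟩ hdeg) ?_
  exact (totalDegree_mul _ _).trans (by rw [totalDegree_C, add_zero]; exact hdeg)

/-- **The modulus dichotomy of the polynomial calculus rung**, on the item's instances: for an
`ℓ`-sparse unsolvable system whose supports form an `(r, c)`-boundary expander (`c > 0`,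
`r ≥ 2`), the clause polynomials of its XOR-CNF are refuted by PC over `𝔽₂` in degree `ℓ`,
while over every field with `2 ≠ 0` (e.g. `𝔽_p`, `p` an odd prime) no PC refutation of degree
`≤ c r / 4` exists — the algebraic shadow of "`p = 2` easy / `p` odd conjectured hard" in
`LinearGeneratorModPFregeHard`. [Buss–Grigoriev–Impagliazzo–Pitassi 2001, §1 and §4–5;
Ben-Sasson–Impagliazzo 2010, §4] [folklore] -/
theorem polyCalc_rung_modulus_dichotomy {K : Type*} [Field K] (h2 : (2 : K) ≠ 0)
    (E : Fin m → LinEqMod 2 n) {ℓ : ℕ} (hsparse : ∀ i, (E i).supp.card ≤ ℓ)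
    (hE : ¬ SystemSat E Finset.univ) {r c : ℝ}
    (hexp : IsBoundaryExpander (fun i => (E i).supp.map Fin.valEmbedding) r c) (hc : 0 < c)
    (hr : 2 ≤ r) :
    PC.RefutableInDegree (cnfPolys (ZMod 2) (sumEncoding 1 E)) ℓ ∧
      ∀ d : ℕ, (d : ℝ) ≤ c * r / 4 → ¬ PC.RefutableInDegree (cnfPolys K (sumEncoding 1 E)) d :=
  ⟨refutableInDegree_sumEncoding_zmod_two E hsparse hE,
    fun _ hd => not_refutableInDegree_sumEncoding h2 E hexp hc hr hd⟩

end Refutation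

end Summit.PneNP.PneNP.Theorems.PolyCalc
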